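import Summits.BirchSwinnertonDyer.BirchSwinnertonDyer.Theorems.PrintCf2RubinValueTwoEllipticUnitsTwoVariableMomentsArtinSteps
import Literature.NumberTheory.EllipticCurves.PAdicOneVariableSeamAlgebra
import HarnessLib

/-!
# THE SEAM IDENTITY of the `j = 0` lane, modulo the per-unit moment identification: de Shalit II.4.14 (38)→(40) for the measure of record —
# `(χ(g_𝔠) − N𝔠) · ∫_{Γ_K} χ dμ = ε_ϑ^k · (−12·A) · ι⁻¹((1 − e_v) · Σ_{𝔟∈T} 𝒲(𝔟)·(N𝔠·E_m(Ω, L𝔟) − E_m(Ω, L(𝔠𝔟))))`, constants explicit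

Cell `bsd-print-cf2`, width seat `bsd-line-cf2-p1-w2` g24 (piece SEAM-ID, part 2); `--supports` the print leaf stmt-BirchSwinnertonDyer-24720
(helper, Theses-free).  THEOREMS ONLY; CONDITIONAL on the published named facts `DeShalit1987.prop24_ii_galoisAction`, `prop24_iii_unit`,
`prop25_i_normRelation` (hypotheses of the frame, never asserted), and on PER-UNIT HYPOTHESES (`hX`, `hΦ`) that are exactly the outputs of
the moment identification (`LubinTateColemanRelativeMomentLogCoordinateTwo` §3 ∘ `FormalGroupLubinTateLogarithmDegreeOnePadic` ∘
`DeShalitThetaTExpansionMoments`) once the CM bridge (`relColemanSeries_eq_subst_subst_of_forall_evS` + the fifth print II.1.5) supplies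
`g_{e(𝔟)} = (Q_𝔟 ∘ [1]_{P′,f}) ∘ [a]_f` for the elliptic units `e_{𝔣_m}(𝔟)` of the family — see `Cruxes/KatzDistributionsAtTwoPrint/MI-SEAM-RECIPE-w2g24.md`.

PRINT (de Shalit II.4.14, proof, p. 71–72): "(38) `≡ Ω_p^{−k} Σ_𝔠 χφ^k(𝔠⁻¹) · ∫_{G_n} φ^k dμ_{σ_𝔠(β(𝔞))}` … we deduce at once from (26) and (17) … (39) …
(40) `(1 − χφ^k(𝔭)/p) · Σ …`".  In the lane (H11 `integral_twoVariable_character_pow_succ_artin_steps`: the moments of the measure of record at the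
chain modulus `𝔣_m` as a cell sum of socket terms `[S⁰] D^k H_{e(𝔟)}`; socket `constantCoeff_mahlerD_iterate_subst_compSeriesC_relTildeSeries`:
`= ε_ϑ^k·j(c_β − u·π′^k·φ c_β)`), THIS FILE proves:

* ★★★ `twist_mul_integral_eq_of_perUnit` — IF every unit `e_{𝔣_m}(𝔟)` of the two label families (`𝔟 = idl (a c′)`, `idl (b c′) = 𝔟·𝔠`) has
  **`Θ(j(c_{e(𝔟)})) = A · ι⁻¹(−12·(N𝔟·E₀ − E(𝔟)))`** (MI: `E₀ = E_m(Ω, L_M)`, `E(𝔟) = E_m(Ω, L𝔟)`, `A = a^m`) and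
  **`Θ(j(φ c_{e(𝔟)})) = A · ι⁻¹(−12·ψ̂·(N𝔟·E(𝔭) − E(𝔭𝔟)))`** (MI after the fifth print: `σ_𝔭 ξ(Ω) = ξ(ψ(𝔭)Ω)` + `eisensteinE_mulLeft`,
  `ψ̂ = λ̃(𝔭)^{−m}`), the weights are `χ(g_𝔟⁻¹) = ι⁻¹(𝒲(𝔟))` with `𝒲(𝔟) = 𝒲(𝔭𝔟)·w_𝔭` (A9: `𝒲 = χ̃⁻¹λ̃^{−m}`), the Euler datum is
  `Θ(j u)·Θ(j π′)^k · ι⁻¹(ψ̂) · ι⁻¹(w_𝔭) = ι⁻¹(e_v)` (`u·π′^k = ψ(𝔭)^m/2`, so `e_v = ε(ϖ_v)⁻¹·2⁻¹`), and the class sum has the same value `S₀` on `T`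
  and on `𝔭T` (both representative systems; the complex side evaluates either), THEN
  **`(χ(g_𝔠) − N𝔠) · μ.integral χ = Θ(ε_ϑ)^k · (−12·A·ι⁻¹((1 − e_v)·S₀))`** — hsum's equation (`…KatzMeasureJZeroIntegrandOfClassSums`) for the
  measure of record with the constant `12·ε_ϑ^{m−1}·a^m` EXPLICIT (the packaging divides by `12·ε_ϑ` — the twelfth root G4/TW — and takes
  `Ω₂ := ε_ϑ·a`); ★★ `twist_mul_eq_of_perUnit_normalised` — the same in hsum's normalised shape: `12·I′ = Θ(ε_ϑ)·∫χ dμ` ⟹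
  `(N𝔠 − χ(g_𝔠))·I′ = (Θ(ε_ϑ)·A₁)^{k+1}·ι⁻¹((1 − e_v)·S₀)` (`A = A₁^{k+1}`; the measure `ε_ϑ·μ/12` has bound `≤ 1` iff G4/TW).

HONEST FRAMING: an assembly of accepted kernel theorems over published named facts and NAMED per-unit hypotheses; nothing here closes a crux; no
summit statement is proved; BSD is not proved by any of this.

## References
* [deShalit1987] E. de Shalit, *Iwasawa theory of elliptic curves with complex multiplication* (1987), II.4.14 (36)–(40) (p. 71–73), II.4.7 (17) (p. 60),
  II.4.10 (26) and Step 2 (p. 64), II.4.12 (29)↔(31) (p. 66–69).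
-/

-- the summit namespace `Summit.BirchSwinnertonDyer.BirchSwinnertonDyer` repeats the problem name by design (D-0017)
set_option linter.dupNamespace false
set_option autoImplicit false

noncomputable section

open scoped Classical nonZeroDivisors
open scoped NumberField
open Field IsDedekindDomain IsDedekindDomain.HeightOneSpectrum ValuativeRel IsLocalRing MvPowerSeries
open Literature.NumberTheory.NumberFields
open Literature.NumberTheory.GaloisRepresentations Literature.NumberTheory.GaloisRepresentations.IsNonarchimedeanLocalField
  Literature.NumberTheory.GaloisRepresentations.LubinTate Literature.NumberTheory.GaloisRepresentations.ArtinLocalGlobal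
  Literature.NumberTheory.PAdicHodge
open Literature.NumberTheory.EllipticCurves Literature.NumberTheory.EllipticCurves.GroupDistribution
open Literature.NumberTheory.ComplexMultiplication.EllipticUnits
open Literature.NumberTheory.LFunctions.AbelianDensity (artinSymbol)
open Summit.BirchSwinnertonDyer.BirchSwinnertonDyer.Theorems.PrintCf2.EllipticUnitsLocal
open Summit.BirchSwinnertonDyer.BirchSwinnertonDyer.Theorems.PrintCf2.EllipticUnitsGlobal
open Summit.BirchSwinnertonDyer.BirchSwinnertonDyer.Theorems.PrintCf2.EllipticUnitsGlobalCompat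
open Summit.BirchSwinnertonDyer.BirchSwinnertonDyer.Theorems.PrintCf2.EllipticUnitsTwoVariable

namespace Summit.BirchSwinnertonDyer.BirchSwinnertonDyer.Theorems.PrintCf2.KatzMeasureJZeroSeam

variable {K : Type} [Field K] [NumberField K] {v : HeightOneSpectrum (𝓞 K)}

attribute [local instance] GlobalNormCoherentUnits.instCommMonoid GlobalNormCoherentUnits.galAction
attribute [local instance] ltNormUniformSpace ltNormIsUniformAddGroup rk1 nF nE fintypeResidueField
attribute [local instance] RelNormCoherentUnits.instCommMonoid

/-- Bridge between the two spellings of the coefficient map on a one-variable series (a `PowerSeries.subst` term is displayed at type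
`MvPowerSeries Unit R`, so `.map` on it elaborates to `MvPowerSeries.map`). [folklore] -/
private theorem mvPowerSeries_map_eq_map' {R S : Type*} [CommRing R] [CommRing S] (f : R →+* S) (P : PowerSeries R) :
    MvPowerSeries.map (σ := Unit) f P = PowerSeries.map f P :=
  rfl

variable [NumberField.IsTotallyComplex K]
  -- the prints and the global frame
  (h24ii : DeShalit1987.prop24_ii_galoisAction) (h24iii : DeShalit1987.prop24_iii_unit) (h25 : DeShalit1987.prop25_i_normRelation)
  (hK : IsImaginaryQuadratic K) (ι : K →+* ℂ)
  -- the moduli: ANY one-prime-step chain `𝔣_{m+1} = 𝔣_m 𝔩_m`, `𝔩_m ∣ 𝔣_m` (`hstep`), all rigid and prime to `v`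
  (𝔣 : ℕ → Ideal (𝓞 K)) (hle : ∀ m, 𝔣 (m + 1) ≤ 𝔣 m)
  (h𝔣0 : ∀ m, 𝔣 m ≠ ⊥) (h𝔣1 : ∀ m, 𝔣 m ≠ ⊤) (hv : ∀ m, ¬ 𝔣 m ≤ v.asIdeal) (hw : ∀ (m : ℕ) (u : (𝓞 K)ˣ), (u : 𝓞 K) - 1 ∈ 𝔣 m → u = 1)
  -- the common local datum at `v`: `π = u·2`, `σ₀`, `ε`, `θ`, `e₂`
  (hq : residueFieldCard (v.adicCompletion K) = 2)
  (h2 : (valuation (v.adicCompletion K)).IsUniformizer ((((2 : ℕ) : 𝒪[v.adicCompletion K]) : v.adicCompletion K)))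
  (u : 𝒪[v.adicCompletion K]ˣ)
  {σ₀ : absoluteGaloisGroup (v.adicCompletion K)} (hσ₀ : IsAbsArithFrob σ₀)
  {ε : (maxUnramifiedCompletion (v.adicCompletion K))ˣ}
  (hε : maxUnramifiedCompletion.galAut (v.adicCompletion K) σ₀ (ε : maxUnramifiedCompletion (v.adicCompletion K)) =
    algebraMap 𝒪[v.adicCompletion K] (maxUnramifiedCompletion (v.adicCompletion K)) (u : 𝒪[v.adicCompletion K]) *
      (ε : maxUnramifiedCompletion (v.adicCompletion K)))
  (θ : CompletedAlgClosure (v.adicCompletion K) →+* ℂ_[2]) (hθc : Continuous θ)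
  (hθ1 : ∀ z : CBall (v.adicCompletion K), ‖θ (z : CompletedAlgClosure (v.adicCompletion K))‖ ≤ 1)
  (hθζ : ∀ ζ' : ℂ_[2], (∃ n : ℕ, ζ' ^ 2 ^ n = 1) →
    ∃ ζ : CompletedAlgClosure (v.adicCompletion K), (∃ n : ℕ, ζ ^ 2 ^ n = 1) ∧ θ ζ = ζ')
  (e₂ : v.adicCompletionIntegers K ≃+* ℤ_[2])
  (hΘe : ∀ a : 𝒪[v.adicCompletion K], (θ.comp ((CBall (v.adicCompletion K)).subtype.comp
      (algebraMap (UnrCoeff (v.adicCompletion K)) (CBall (v.adicCompletion K))))) (intToUnrCoeff (v.adicCompletion K) a) =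
    padicIntCast ℂ_[2] (((e₂ : v.adicCompletionIntegers K →+* ℤ_[2]).comp
      (integerEquivAdicCompletionIntegers v).toRingHom) a))
  -- the per-modulus local models: global witnesses `α_m = π^{f_m}`, coefficient fields `E_m ≤ E_{m+1}`, readings `j_m`, cell maps `ψ_m`
  (α : ℕ → 𝓞 K) (hα0 : ∀ m, α m ≠ 0) (hα𝔣 : ∀ m, α m - 1 ∈ 𝔣 m) (hαw : ∀ m (w : HeightOneSpectrum (𝓞 K)), w ≠ v → α m ∉ w.asIdeal)
  (f : ℕ → ℕ) (hαπ : ∀ m, ((α m : K) : v.adicCompletion K) =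
    ((((u : 𝒪[v.adicCompletion K]) * ((2 : ℕ) : 𝒪[v.adicCompletion K]) : 𝒪[v.adicCompletion K]) : v.adicCompletion K)) ^ f m)
  (E : ℕ → IntermediateField (v.adicCompletion K) (AlgebraicClosure (v.adicCompletion K)))
  [hfd : ∀ m, FiniteDimensional (v.adicCompletion K) (E m)] [hgal : ∀ m, IsGalois (v.adicCompletion K) (E m)]
  (hE : ∀ m, E m ≤ maxUnramified (v.adicCompletion K))
  (hdegE : ∀ (m : ℕ) (w : WeilGroup (v.adicCompletion K)),
    WeilGroup.toAbsGalois (v.adicCompletion K) w ∈ (E m).fixingSubgroup → (f m : ℤ) ∣ WeilGroup.deg w)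
  (hEE : ∀ m, E m ≤ E (m + 1))
  (j : ∀ m : ℕ, unitBall (E m) →+* UnrCoeff (v.adicCompletion K))
  (hj : ∀ m, (j m).comp (algebraMap (LTCoeff (v.adicCompletion K)) (unitBall (E m))) =
    (intToUnrCoeff (v.adicCompletion K)).comp (LTCoeff.of (v.adicCompletion K)).symm.toRingHom)
  (hjC : ∀ m, (algebraMap (UnrCoeff (v.adicCompletion K)) (CBall (v.adicCompletion K))).comp (j m) = unitBallToCBall (E m))
  (hjj : ∀ (m : ℕ) (y : unitBall (E m)), j (m + 1) (inclUnitBall (F := v.adicCompletion K) (hEE m) y) = j m y)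
  (ψ : ∀ m n : ℕ, ↥(absRestrictNormalHom (rayClassField K (𝔣 m))).ker ⧸ (rayAdicTower (𝔪 := 𝔣 m) (h𝔣0 m) v).U n → ZMod (2 ^ (n + 1)))
  (hψ : ∀ (m n : ℕ) (g : ↥(absRestrictNormalHom (rayClassField K (𝔣 m))).ker), g ∈ (rayAdicTower (𝔪 := 𝔣 m) (h𝔣0 m) v).U 0 →
    ψ m n ((rayAdicTower (𝔪 := 𝔣 m) (h𝔣0 m) v).proj n g) =
      PadicInt.toZModPow (n + 1) ((((Units.map (e₂ : v.adicCompletionIntegers K →+* ℤ_[2]).toMonoidHom).comp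
        (rayAdicCharacter (h𝔣0 m) (hv m) (hw m)))⁻¹ g : ℤ_[2]ˣ) : ℤ_[2]))
  -- the twists: ideals `𝔠` prime to all `𝔣_m v`, Galois lifts `g_𝔠 ∈ Γ_K` of their Artin symbols on every `K(𝔣_m v^{k+1})`,
  -- elliptic-unit families at every modulus
  {I : Type*} (idl : I → Ideal (𝓞 K)) (hidl0 : ∀ i, idl i ≠ ⊥) (hidlc : ∀ i m, IsCoprime (idl i) (𝔣 m * v.asIdeal))
  (g : I → absoluteGaloisGroup K)
  (hg : ∀ (i : I) (m k : ℕ), absRestrictNormalHom (rayClassField K (𝔣 m * v.asIdeal ^ (k + 1))) (g i) =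
    artinSymbol (galFrob K (rayClassField K (𝔣 m * v.asIdeal ^ (k + 1)))) (idl i))
  (x : ∀ (i : I) (m k : ℕ), rayClassField K (𝔣 m * v.asIdeal ^ (k + 1)))
  (hx : ∀ (i : I) (m k : ℕ), IsThetaValueOne ι (𝔣 m * v.asIdeal ^ (k + 1)) (idl i)
    (algClosureEmb ι ((x i m k : rayClassField K (𝔣 m * v.asIdeal ^ (k + 1))) : AlgebraicClosure K)))
  [hN : ∀ m n, ((rayAdicTower (𝔪 := 𝔣 m) (h𝔣0 m) v).U n).Normal]
  [hNabs : ∀ m n, ((absRayAdicTower (𝔪' := 𝔣 m) (h𝔣0 m) v).U n).Normal]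

set_option maxHeartbeats 1600000 in
include h24ii hj hΘe hjj hθc hθζ hg in
/-- ★★★ **THE SEAM IDENTITY MODULO THE PER-UNIT MOMENT IDENTIFICATION** (de Shalit II.4.14 (38)→(40) at `j = 0` for the measure of record, constants
explicit): in H11's frame at the chain modulus `𝔣_m`, with `cβ i = c_{e_{𝔣_m}(idl i)} = [X⁰] D_{E_m}^[k] (δ g_{e(idl i)})` the relative Coates–Wiles values of
the elliptic units of the two label families (`idl (b c′) = idl (a c′)·𝔠`), `Θ = θ ∘ (𝐃 ⊂ ℂ_F)`, `ι⁻¹ = ((ιp.symm ·) : ℂ → ℚ̄₂ ⊂ ℂ₂)`: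
IF `Θ(j(cβ i)) = A·ι⁻¹(−12·(N𝔟·E₀ − E 𝔟))` and `Θ(j(φ (cβ i))) = A·ι⁻¹(−12·ψ̂·(N𝔟·E 𝔭 − E(𝔭𝔟)))` (`𝔟 = idl i`, `𝔭 = v`), the weights are
`χ(g_i⁻¹) = ι⁻¹(𝒲(idl i))` with `𝒲 𝔟 = 𝒲(𝔭𝔟)·w_𝔭` on `T = idl(a(cells))`, `Θ(j u)·Θ(j π′)^k·ι⁻¹(ψ̂)·ι⁻¹(w_𝔭) = ι⁻¹(e_v)`, and the class sum
`Σ 𝒲(𝔟)·(N𝔠·E 𝔟 − E(𝔠𝔟))` equals `S₀` over `T` and over `𝔭T`, THEN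
`(χ(g_𝔠) − N𝔠) · ∫_{Γ_K} χ dμ = Θ(ε_ϑ)^k · (−12·A·ι⁻¹((1 − e_v)·S₀))`.
GIVEN II.2.4 (ii)/(iii), II.2.5 (i). [cite: deShalit1987, II.4.14 (38)–(40) (p. 71–72), II.4.7 (17) (p. 60), II.4.10 (26) and Step 2 (p. 64)] -/
theorem twist_mul_integral_eq_of_perUnit
    (hstep : ∀ m, ∃ 𝔩 : HeightOneSpectrum (𝓞 K), 𝔣 (m + 1) = 𝔣 m * 𝔩.asIdeal ∧ 𝔩.asIdeal ∣ 𝔣 m)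
    (μ : GroupDistribution (SubgroupTower.diagonal (fun m ↦ absRayAdicTower (𝔪' := 𝔣 m) (h𝔣0 m) v)
        (fun m n ↦ absRayAdicTower_U_anti (h𝔣0 m) (h𝔣0 (m + 1)) v (hle m) n)) ℂ_[2]) (c : I)
    (hμ : ∀ (n : ℕ) (b : absoluteGaloisGroup K ⧸ (absRayAdicTower (𝔪' := 𝔣 n) (h𝔣0 n) v).U n),
        (twisting (g c) (Ideal.absNorm (idl c) : ℂ_[2]) μ).μ n b =
        (GroupDistribution.induceFrom (Γ := absoluteGaloisGroup K) (fun k ↦ rayAdicTower_U_eq_subgroupOf (𝔪 := 𝔣 n) (h𝔣0 n) v k)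
          (fun b : GlobalNormCoherentUnits (h𝔣0 n) v ↦
            localMeasureFamily (h𝔣0 n) (hv n) (hw n) hq h2 u (E n) (hE n) hσ₀ hε θ hθ1 (j n) (hjC n) e₂ (ψ n) (hψ n)
              (RelNormCoherentUnits.ofGlobalUnits (h𝔣0 n) (hv n) (hw n) (isUniformizer_unit_mul h2 u) (hα0 n) (hα𝔣 n) (hαw n)
                (hαπ n) (E n) (hE n) (hdegE n) b))
          zero_le_one (fun _ ↦ le_rfl)
          (ellipticUnitsGlobal h24iii h25 hK ι (h𝔣0 n) (h𝔣1 n) (hv n) (hw n) (hidl0 c) (hidlc c n) (x c n) (hx c n))).μ n b)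
    (m k : ℕ) {χ : absoluteGaloisGroup K → ℂ_[2]} (hχc : (absRayAdicTower (𝔪' := 𝔣 m) (h𝔣0 m) v).IsTowerContinuous χ)
    (hχ : ∀ y z, χ (y * z) = χ y * χ z) (h1 : χ 1 = 1) (hne : χ (g c) ≠ (Ideal.absNorm (idl c) : ℂ_[2]))
    (hχG : ∀ y : ↥(absRestrictNormalHom (rayClassField K (𝔣 m))).ker, χ y =
      padicIntCast ℂ_[2] (((((Units.map (e₂ : v.adicCompletionIntegers K →+* ℤ_[2]).toMonoidHom).comp
        (rayAdicCharacter (h𝔣0 m) (hv m) (hw m)))⁻¹) y : ℤ_[2]) ^ (k + 1)))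
    (a : absoluteGaloisGroup K ⧸ (absRayAdicTower (𝔪' := 𝔣 m) (h𝔣0 m) v).U 0 → I)
    (ha : ∀ c', (absRayAdicTower (𝔪' := 𝔣 m) (h𝔣0 m) v).proj 0 (g (a c')) = c'⁻¹)
    (b : absoluteGaloisGroup K ⧸ (absRayAdicTower (𝔪' := 𝔣 m) (h𝔣0 m) v).U 0 → I) (hb : ∀ c', idl (b c') = idl (a c') * idl c)
    -- the per-unit relative Coates–Wiles values of the units of the two families
    (cβ : I → unitBall (E m))
    (hcβ : ∀ i, cβ i = PowerSeries.constantCoeff ((fun g' : PowerSeries (unitBall (E m)) =>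
        (invDiff (isLTRing_LTCoeff (isUniformizer_unit_mul h2 u))
            (isLTSeries_LTCoeff ((u : 𝒪[v.adicCompletion K]) * ((2 : ℕ) : 𝒪[v.adicCompletion K])))).map
            (algebraMap (LTCoeff (v.adicCompletion K)) (unitBall (E m))) *
          PowerSeries.derivative (unitBall (E m)) g')^[k]
        (relLogDerivSeries (isUniformizer_unit_mul h2 u) (E m) hq (hE m) hσ₀
          (RelNormCoherentUnits.ofGlobalUnits (h𝔣0 m) (hv m) (hw m) (isUniformizer_unit_mul h2 u) (hα0 m) (hα𝔣 m) (hαw m)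
            (hαπ m) (E m) (hE m) (hdegE m)
            (ellipticUnitsGlobal h24iii h25 hK ι (h𝔣0 m) (h𝔣1 m) (hv m) (hw m) (hidl0 i) (hidlc i m) (x i m) (hx i m))))))
    -- the `p`-adic ↔ complex identification of algebraic numbers and the labels' image
    (ιp : PadicAlgCl 2 ≃+* ℂ) (hinj : Set.InjOn (fun c' ↦ idl (a c')) ((absRayAdicTower (𝔪' := 𝔣 m) (h𝔣0 m) v).cells 0))
    {T : Finset (Ideal (𝓞 K))} (hT : T = ((absRayAdicTower (𝔪' := 𝔣 m) (h𝔣0 m) v).cells 0).image fun c' ↦ idl (a c'))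
    -- the weights (A9's output shape) and their multiplicativity at `𝔭 = v`
    (𝒲 : Ideal (𝓞 K) → ℂ)
    (hχg : ∀ c' ∈ (absRayAdicTower (𝔪' := 𝔣 m) (h𝔣0 m) v).cells 0,
      χ (g (a c'))⁻¹ = ((ιp.symm (𝒲 (idl (a c'))) : PadicAlgCl 2) : ℂ_[2]))
    (w𝔭 : ℂ) (h𝒲 : ∀ 𝔟 ∈ T, 𝒲 𝔟 = 𝒲 (v.asIdeal * 𝔟) * w𝔭)
    -- the per-unit moment identification (MI + bridge) and its Frobenius image (fifth print)
    (A : ℂ_[2]) (E₀ ψhat : ℂ) (Ev : Ideal (𝓞 K) → ℂ)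
    (hX : ∀ c' ∈ (absRayAdicTower (𝔪' := 𝔣 m) (h𝔣0 m) v).cells 0,
      (θ.comp ((CBall (v.adicCompletion K)).subtype.comp
          (algebraMap (UnrCoeff (v.adicCompletion K)) (CBall (v.adicCompletion K))))) (j m (cβ (a c'))) =
        A * ((ιp.symm (-12 * ((Ideal.absNorm (idl (a c')) : ℂ) * E₀ - Ev (idl (a c')))) : PadicAlgCl 2) : ℂ_[2]) ∧
      (θ.comp ((CBall (v.adicCompletion K)).subtype.comp
          (algebraMap (UnrCoeff (v.adicCompletion K)) (CBall (v.adicCompletion K))))) (j m (cβ (b c'))) =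
        A * ((ιp.symm (-12 * ((Ideal.absNorm (idl (b c')) : ℂ) * E₀ - Ev (idl (b c')))) : PadicAlgCl 2) : ℂ_[2]))
    (hΦ : ∀ c' ∈ (absRayAdicTower (𝔪' := 𝔣 m) (h𝔣0 m) v).cells 0,
      (θ.comp ((CBall (v.adicCompletion K)).subtype.comp
          (algebraMap (UnrCoeff (v.adicCompletion K)) (CBall (v.adicCompletion K)))))
          (j m ((frobUnitBall (E m) σ₀ : unitBall (E m) →+* unitBall (E m)) (cβ (a c')))) =
        A * ((ιp.symm (-12 * (ψhat * ((Ideal.absNorm (idl (a c')) : ℂ) * Ev v.asIdeal - Ev (v.asIdeal * idl (a c'))))) : PadicAlgCl 2) : ℂ_[2]) ∧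
      (θ.comp ((CBall (v.adicCompletion K)).subtype.comp
          (algebraMap (UnrCoeff (v.adicCompletion K)) (CBall (v.adicCompletion K)))))
          (j m ((frobUnitBall (E m) σ₀ : unitBall (E m) →+* unitBall (E m)) (cβ (b c')))) =
        A * ((ιp.symm (-12 * (ψhat * ((Ideal.absNorm (idl (b c')) : ℂ) * Ev v.asIdeal - Ev (v.asIdeal * idl (b c'))))) : PadicAlgCl 2) : ℂ_[2]))
    -- the Euler datum `u·π′^k ↔ ψ(𝔭)^m/2` and the invariance of the class sum under `T ↦ 𝔭T`
    (e_v : ℂ)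
    (hW : (θ.comp ((CBall (v.adicCompletion K)).subtype.comp
          (algebraMap (UnrCoeff (v.adicCompletion K)) (CBall (v.adicCompletion K)))))
            (j m (algebraMap (LTCoeff (v.adicCompletion K)) (unitBall (E m))
              (LTCoeff.of (v.adicCompletion K) (u : 𝒪[v.adicCompletion K])))) *
        (θ.comp ((CBall (v.adicCompletion K)).subtype.comp
          (algebraMap (UnrCoeff (v.adicCompletion K)) (CBall (v.adicCompletion K)))))
            (j m (algebraMap (LTCoeff (v.adicCompletion K)) (unitBall (E m))
              (LTCoeff.of (v.adicCompletion K) ((u : 𝒪[v.adicCompletion K]) * ((2 : ℕ) : 𝒪[v.adicCompletion K]))))) ^ k *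
        ((ιp.symm ψhat : PadicAlgCl 2) : ℂ_[2]) * ((ιp.symm w𝔭 : PadicAlgCl 2) : ℂ_[2]) = ((ιp.symm e_v : PadicAlgCl 2) : ℂ_[2]))
    {S₀ : ℂ} (hST : ∑ 𝔟 ∈ T, 𝒲 𝔟 * ((Ideal.absNorm (idl c) : ℂ) * Ev 𝔟 - Ev (idl c * 𝔟)) = S₀)
    (hST𝔭 : ∑ 𝔟' ∈ T.image (v.asIdeal * ·), 𝒲 𝔟' * ((Ideal.absNorm (idl c) : ℂ) * Ev 𝔟' - Ev (idl c * 𝔟')) = S₀) :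
    (χ (g c) - (Ideal.absNorm (idl c) : ℂ_[2])) * μ.integral χ =
      (θ.comp ((CBall (v.adicCompletion K)).subtype.comp
          (algebraMap (UnrCoeff (v.adicCompletion K)) (CBall (v.adicCompletion K)))))
            (PowerSeries.coeff 1 (compSeriesC h2 hσ₀ u hε)) ^ k *
        (-12 * A * ((ιp.symm ((1 - e_v) * S₀) : PadicAlgCl 2) : ℂ_[2])) := by
  -- H11: the integral as a cell sum of socket terms
  rw [integral_twoVariable_character_pow_succ_artin_steps h24ii h24iii h25 hK ι 𝔣 hle h𝔣0 h𝔣1 hv hw hq h2 u hσ₀ hε θ hθc hθ1 hθζ e₂ hΘe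
    α hα0 hα𝔣 hαw f hαπ E hE hdegE hEE j hj hjC hjj ψ hψ idl hidl0 hidlc g hg x hx hstep μ c hμ m k hχc hχ h1 hne hχG a ha b hb,
    mul_inv_cancel_left₀ (sub_ne_zero.mpr hne)]
  try simp only [mvPowerSeries_map_eq_map']
  -- abbreviations (AFTER the rewrite, so that every occurrence is folded)
  set Θ : UnrCoeff (v.adicCompletion K) →+* ℂ_[2] := θ.comp ((CBall (v.adicCompletion K)).subtype.comp
    (algebraMap (UnrCoeff (v.adicCompletion K)) (CBall (v.adicCompletion K)))) with hΘ
  set τ : ℂ →+* ℂ_[2] := (algebraMap (PadicAlgCl 2) ℂ_[2]).comp ιp.symm.toRingHom with hτ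
  have hτapp : ∀ z : ℂ, ((ιp.symm z : PadicAlgCl 2) : ℂ_[2]) = τ z := fun z ↦ rfl
  -- each socket term read through `Θ`
  have hsock : ∀ i : I, PowerSeries.constantCoeff (mahlerD^[k] (PowerSeries.map Θ
      (PowerSeries.subst (compSeriesC h2 hσ₀ u hε)
        ((relTildeSeries (isUniformizer_unit_mul h2 u) (E m) hq (hE m) hσ₀
          (LTCoeff.of (v.adicCompletion K) (u : 𝒪[v.adicCompletion K]))
          (RelNormCoherentUnits.ofGlobalUnits (h𝔣0 m) (hv m) (hw m) (isUniformizer_unit_mul h2 u) (hα0 m) (hα𝔣 m) (hαw m)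
            (hαπ m) (E m) (hE m) (hdegE m)
            (ellipticUnitsGlobal h24iii h25 hK ι (h𝔣0 m) (h𝔣1 m) (hv m) (hw m) (hidl0 i) (hidlc i m) (x i m) (hx i m)))).map
          (j m))))) =
      Θ (PowerSeries.coeff 1 (compSeriesC h2 hσ₀ u hε)) ^ k *
        (Θ (j m (cβ i)) -
          Θ (j m (algebraMap (LTCoeff (v.adicCompletion K)) (unitBall (E m)) (LTCoeff.of (v.adicCompletion K) (u : 𝒪[v.adicCompletion K])))) *
            Θ (j m (algebraMap (LTCoeff (v.adicCompletion K)) (unitBall (E m))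
              (LTCoeff.of (v.adicCompletion K) ((u : 𝒪[v.adicCompletion K]) * ((2 : ℕ) : 𝒪[v.adicCompletion K]))))) ^ k *
            Θ (j m ((frobUnitBall (E m) σ₀ : unitBall (E m) →+* unitBall (E m)) (cβ i)))) := fun i ↦ by
    rw [hcβ i]
    exact constantCoeff_mahlerD_iterate_map_subst_compSeriesC_relTildeSeries hq h2 hσ₀ u hε (E m) (hE m) (j m) (hj m) Θ _ k _
  simp only [hsock]
  -- pull `Θ(ε)^k` out and apply the cell-sum algebra
  have hcells : ∑ c' ∈ (absRayAdicTower (𝔪' := 𝔣 m) (h𝔣0 m) v).cells 0, χ (g (a c'))⁻¹ *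
      (Θ (PowerSeries.coeff 1 (compSeriesC h2 hσ₀ u hε)) ^ k *
          (Θ (j m (cβ (b c'))) -
            Θ (j m (algebraMap (LTCoeff (v.adicCompletion K)) (unitBall (E m)) (LTCoeff.of (v.adicCompletion K) (u : 𝒪[v.adicCompletion K])))) *
              Θ (j m (algebraMap (LTCoeff (v.adicCompletion K)) (unitBall (E m))
                (LTCoeff.of (v.adicCompletion K) ((u : 𝒪[v.adicCompletion K]) * ((2 : ℕ) : 𝒪[v.adicCompletion K]))))) ^ k *
              Θ (j m ((frobUnitBall (E m) σ₀ : unitBall (E m) →+* unitBall (E m)) (cβ (b c'))))) -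
        (Ideal.absNorm (idl c) : ℂ_[2]) *
          (Θ (PowerSeries.coeff 1 (compSeriesC h2 hσ₀ u hε)) ^ k *
            (Θ (j m (cβ (a c'))) -
              Θ (j m (algebraMap (LTCoeff (v.adicCompletion K)) (unitBall (E m)) (LTCoeff.of (v.adicCompletion K) (u : 𝒪[v.adicCompletion K])))) *
                Θ (j m (algebraMap (LTCoeff (v.adicCompletion K)) (unitBall (E m))
                  (LTCoeff.of (v.adicCompletion K) ((u : 𝒪[v.adicCompletion K]) * ((2 : ℕ) : 𝒪[v.adicCompletion K]))))) ^ k *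
                Θ (j m ((frobUnitBall (E m) σ₀ : unitBall (E m) →+* unitBall (E m)) (cβ (a c'))))))) =
      Θ (PowerSeries.coeff 1 (compSeriesC h2 hσ₀ u hε)) ^ k *
        ∑ c' ∈ (absRayAdicTower (𝔪' := 𝔣 m) (h𝔣0 m) v).cells 0, χ (g (a c'))⁻¹ *
          ((Θ (j m (cβ (b c'))) - (Ideal.absNorm (idl c) : ℂ_[2]) * Θ (j m (cβ (a c')))) -
            Θ (j m (algebraMap (LTCoeff (v.adicCompletion K)) (unitBall (E m)) (LTCoeff.of (v.adicCompletion K) (u : 𝒪[v.adicCompletion K])))) *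
              Θ (j m (algebraMap (LTCoeff (v.adicCompletion K)) (unitBall (E m))
                (LTCoeff.of (v.adicCompletion K) ((u : 𝒪[v.adicCompletion K]) * ((2 : ℕ) : 𝒪[v.adicCompletion K]))))) ^ k *
            (Θ (j m ((frobUnitBall (E m) σ₀ : unitBall (E m) →+* unitBall (E m)) (cβ (b c')))) -
              (Ideal.absNorm (idl c) : ℂ_[2]) * Θ (j m ((frobUnitBall (E m) σ₀ : unitBall (E m) →+* unitBall (E m)) (cβ (a c')))))) := by
    rw [Finset.mul_sum]
    refine Finset.sum_congr rfl fun c' _ ↦ ?_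
    ring
  rw [hcells]
  congr 1
  simp only [hτapp] at hχg hX hΦ hW ⊢
  exact sum_cells_perUnit_eq_of_sum_image_eq τ ((absRayAdicTower (𝔪' := 𝔣 m) (h𝔣0 m) v).cells 0) a b idl
    (𝔡 := idl c) (𝔭 := v.asIdeal) v.ne_bot (fun c' _ ↦ hb c') hinj hT (fun i ↦ χ (g i)⁻¹) (fun i ↦ Θ (j m (cβ i)))
    (fun i ↦ Θ (j m ((frobUnitBall (E m) σ₀ : unitBall (E m) →+* unitBall (E m)) (cβ i)))) 𝒲 hχg w𝔭 h𝒲 A _ E₀ ψhat Ev hX hΦ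
    hST hST𝔭 hW

set_option maxHeartbeats 1600000 in
include h24ii hj hΘe hjj hθc hθζ hg in
/-- ★★ **The seam identity in hsum's NORMALISED shape**: with `A = A₁^{k+1}` (`A₁ = Θ(j a)`, the Tate-module unit read in `ℂ₂`) and any value `I′`
with `12·I′ = Θ(ε_ϑ)·∫_{Γ_K} χ dμ` (the integral against the measure `μ′ := ε_ϑ·μ_record/12` of the packaging — its bound `≤ 1` is the twelfth-root
input G4/TW, NOT proved here), the identity reads
`(N𝔠 − χ(g_𝔠)) · I′ = (Θ(ε_ϑ)·A₁)^{k+1} · ι⁻¹((1 − e_v)·S₀)` — hsum's equation (`…KatzMeasureJZeroIntegrandOfClassSums`) with `Ω₂ := ε_ϑ·a`, `m = k+1`.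
GIVEN II.2.4 (ii)/(iii), II.2.5 (i). [cite: deShalit1987, II.4.14 (36)–(40) (p. 71–73), II.4.12 (31) and end of proof (p. 66–69)] -/
theorem twist_mul_eq_of_perUnit_normalised
    (hstep : ∀ m, ∃ 𝔩 : HeightOneSpectrum (𝓞 K), 𝔣 (m + 1) = 𝔣 m * 𝔩.asIdeal ∧ 𝔩.asIdeal ∣ 𝔣 m)
    (μ : GroupDistribution (SubgroupTower.diagonal (fun m ↦ absRayAdicTower (𝔪' := 𝔣 m) (h𝔣0 m) v)
        (fun m n ↦ absRayAdicTower_U_anti (h𝔣0 m) (h𝔣0 (m + 1)) v (hle m) n)) ℂ_[2]) (c : I)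
    (hμ : ∀ (n : ℕ) (b : absoluteGaloisGroup K ⧸ (absRayAdicTower (𝔪' := 𝔣 n) (h𝔣0 n) v).U n),
        (twisting (g c) (Ideal.absNorm (idl c) : ℂ_[2]) μ).μ n b =
        (GroupDistribution.induceFrom (Γ := absoluteGaloisGroup K) (fun k ↦ rayAdicTower_U_eq_subgroupOf (𝔪 := 𝔣 n) (h𝔣0 n) v k)
          (fun b : GlobalNormCoherentUnits (h𝔣0 n) v ↦
            localMeasureFamily (h𝔣0 n) (hv n) (hw n) hq h2 u (E n) (hE n) hσ₀ hε θ hθ1 (j n) (hjC n) e₂ (ψ n) (hψ n)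
              (RelNormCoherentUnits.ofGlobalUnits (h𝔣0 n) (hv n) (hw n) (isUniformizer_unit_mul h2 u) (hα0 n) (hα𝔣 n) (hαw n)
                (hαπ n) (E n) (hE n) (hdegE n) b))
          zero_le_one (fun _ ↦ le_rfl)
          (ellipticUnitsGlobal h24iii h25 hK ι (h𝔣0 n) (h𝔣1 n) (hv n) (hw n) (hidl0 c) (hidlc c n) (x c n) (hx c n))).μ n b)
    (m k : ℕ) {χ : absoluteGaloisGroup K → ℂ_[2]} (hχc : (absRayAdicTower (𝔪' := 𝔣 m) (h𝔣0 m) v).IsTowerContinuous χ)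
    (hχ : ∀ y z, χ (y * z) = χ y * χ z) (h1 : χ 1 = 1) (hne : χ (g c) ≠ (Ideal.absNorm (idl c) : ℂ_[2]))
    (hχG : ∀ y : ↥(absRestrictNormalHom (rayClassField K (𝔣 m))).ker, χ y =
      padicIntCast ℂ_[2] (((((Units.map (e₂ : v.adicCompletionIntegers K →+* ℤ_[2]).toMonoidHom).comp
        (rayAdicCharacter (h𝔣0 m) (hv m) (hw m)))⁻¹) y : ℤ_[2]) ^ (k + 1)))
    (a : absoluteGaloisGroup K ⧸ (absRayAdicTower (𝔪' := 𝔣 m) (h𝔣0 m) v).U 0 → I)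
    (ha : ∀ c', (absRayAdicTower (𝔪' := 𝔣 m) (h𝔣0 m) v).proj 0 (g (a c')) = c'⁻¹)
    (b : absoluteGaloisGroup K ⧸ (absRayAdicTower (𝔪' := 𝔣 m) (h𝔣0 m) v).U 0 → I) (hb : ∀ c', idl (b c') = idl (a c') * idl c)
    -- the per-unit relative Coates–Wiles values of the units of the two families
    (cβ : I → unitBall (E m))
    (hcβ : ∀ i, cβ i = PowerSeries.constantCoeff ((fun g' : PowerSeries (unitBall (E m)) =>
        (invDiff (isLTRing_LTCoeff (isUniformizer_unit_mul h2 u))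
            (isLTSeries_LTCoeff ((u : 𝒪[v.adicCompletion K]) * ((2 : ℕ) : 𝒪[v.adicCompletion K])))).map
            (algebraMap (LTCoeff (v.adicCompletion K)) (unitBall (E m))) *
          PowerSeries.derivative (unitBall (E m)) g')^[k]
        (relLogDerivSeries (isUniformizer_unit_mul h2 u) (E m) hq (hE m) hσ₀
          (RelNormCoherentUnits.ofGlobalUnits (h𝔣0 m) (hv m) (hw m) (isUniformizer_unit_mul h2 u) (hα0 m) (hα𝔣 m) (hαw m)
            (hαπ m) (E m) (hE m) (hdegE m)
            (ellipticUnitsGlobal h24iii h25 hK ι (h𝔣0 m) (h𝔣1 m) (hv m) (hw m) (hidl0 i) (hidlc i m) (x i m) (hx i m))))))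
    -- the `p`-adic ↔ complex identification of algebraic numbers and the labels' image
    (ιp : PadicAlgCl 2 ≃+* ℂ) (hinj : Set.InjOn (fun c' ↦ idl (a c')) ((absRayAdicTower (𝔪' := 𝔣 m) (h𝔣0 m) v).cells 0))
    {T : Finset (Ideal (𝓞 K))} (hT : T = ((absRayAdicTower (𝔪' := 𝔣 m) (h𝔣0 m) v).cells 0).image fun c' ↦ idl (a c'))
    -- the weights (A9's output shape) and their multiplicativity at `𝔭 = v`
    (𝒲 : Ideal (𝓞 K) → ℂ)
    (hχg : ∀ c' ∈ (absRayAdicTower (𝔪' := 𝔣 m) (h𝔣0 m) v).cells 0,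
      χ (g (a c'))⁻¹ = ((ιp.symm (𝒲 (idl (a c'))) : PadicAlgCl 2) : ℂ_[2]))
    (w𝔭 : ℂ) (h𝒲 : ∀ 𝔟 ∈ T, 𝒲 𝔟 = 𝒲 (v.asIdeal * 𝔟) * w𝔭)
    -- the per-unit moment identification (MI + bridge) and its Frobenius image (fifth print)
    (A : ℂ_[2]) (E₀ ψhat : ℂ) (Ev : Ideal (𝓞 K) → ℂ)
    (hX : ∀ c' ∈ (absRayAdicTower (𝔪' := 𝔣 m) (h𝔣0 m) v).cells 0,
      (θ.comp ((CBall (v.adicCompletion K)).subtype.comp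
          (algebraMap (UnrCoeff (v.adicCompletion K)) (CBall (v.adicCompletion K))))) (j m (cβ (a c'))) =
        A * ((ιp.symm (-12 * ((Ideal.absNorm (idl (a c')) : ℂ) * E₀ - Ev (idl (a c')))) : PadicAlgCl 2) : ℂ_[2]) ∧
      (θ.comp ((CBall (v.adicCompletion K)).subtype.comp
          (algebraMap (UnrCoeff (v.adicCompletion K)) (CBall (v.adicCompletion K))))) (j m (cβ (b c'))) =
        A * ((ιp.symm (-12 * ((Ideal.absNorm (idl (b c')) : ℂ) * E₀ - Ev (idl (b c')))) : PadicAlgCl 2) : ℂ_[2]))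
    (hΦ : ∀ c' ∈ (absRayAdicTower (𝔪' := 𝔣 m) (h𝔣0 m) v).cells 0,
      (θ.comp ((CBall (v.adicCompletion K)).subtype.comp
          (algebraMap (UnrCoeff (v.adicCompletion K)) (CBall (v.adicCompletion K)))))
          (j m ((frobUnitBall (E m) σ₀ : unitBall (E m) →+* unitBall (E m)) (cβ (a c')))) =
        A * ((ιp.symm (-12 * (ψhat * ((Ideal.absNorm (idl (a c')) : ℂ) * Ev v.asIdeal - Ev (v.asIdeal * idl (a c'))))) : PadicAlgCl 2) : ℂ_[2]) ∧
      (θ.comp ((CBall (v.adicCompletion K)).subtype.comp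
          (algebraMap (UnrCoeff (v.adicCompletion K)) (CBall (v.adicCompletion K)))))
          (j m ((frobUnitBall (E m) σ₀ : unitBall (E m) →+* unitBall (E m)) (cβ (b c')))) =
        A * ((ιp.symm (-12 * (ψhat * ((Ideal.absNorm (idl (b c')) : ℂ) * Ev v.asIdeal - Ev (v.asIdeal * idl (b c'))))) : PadicAlgCl 2) : ℂ_[2]))
    -- the Euler datum `u·π′^k ↔ ψ(𝔭)^m/2` and the invariance of the class sum under `T ↦ 𝔭T`
    (e_v : ℂ)
    (hW : (θ.comp ((CBall (v.adicCompletion K)).subtype.comp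
          (algebraMap (UnrCoeff (v.adicCompletion K)) (CBall (v.adicCompletion K)))))
            (j m (algebraMap (LTCoeff (v.adicCompletion K)) (unitBall (E m))
              (LTCoeff.of (v.adicCompletion K) (u : 𝒪[v.adicCompletion K])))) *
        (θ.comp ((CBall (v.adicCompletion K)).subtype.comp
          (algebraMap (UnrCoeff (v.adicCompletion K)) (CBall (v.adicCompletion K)))))
            (j m (algebraMap (LTCoeff (v.adicCompletion K)) (unitBall (E m))
              (LTCoeff.of (v.adicCompletion K) ((u : 𝒪[v.adicCompletion K]) * ((2 : ℕ) : 𝒪[v.adicCompletion K]))))) ^ k *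
        ((ιp.symm ψhat : PadicAlgCl 2) : ℂ_[2]) * ((ιp.symm w𝔭 : PadicAlgCl 2) : ℂ_[2]) = ((ιp.symm e_v : PadicAlgCl 2) : ℂ_[2]))
    {S₀ : ℂ} (hST : ∑ 𝔟 ∈ T, 𝒲 𝔟 * ((Ideal.absNorm (idl c) : ℂ) * Ev 𝔟 - Ev (idl c * 𝔟)) = S₀)
    (hST𝔭 : ∑ 𝔟' ∈ T.image (v.asIdeal * ·), 𝒲 𝔟' * ((Ideal.absNorm (idl c) : ℂ) * Ev 𝔟' - Ev (idl c * 𝔟')) = S₀)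
    (A₁ : ℂ_[2]) (hA : A = A₁ ^ (k + 1)) (I' : ℂ_[2])
    (hI : (12 : ℂ_[2]) * I' =
      (θ.comp ((CBall (v.adicCompletion K)).subtype.comp
          (algebraMap (UnrCoeff (v.adicCompletion K)) (CBall (v.adicCompletion K)))))
            (PowerSeries.coeff 1 (compSeriesC h2 hσ₀ u hε)) * μ.integral χ) :
    ((Ideal.absNorm (idl c) : ℂ_[2]) - χ (g c)) * I' =
      ((θ.comp ((CBall (v.adicCompletion K)).subtype.comp
          (algebraMap (UnrCoeff (v.adicCompletion K)) (CBall (v.adicCompletion K)))))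
            (PowerSeries.coeff 1 (compSeriesC h2 hσ₀ u hε)) * A₁) ^ (k + 1) *
        ((ιp.symm ((1 - e_v) * S₀) : PadicAlgCl 2) : ℂ_[2]) := by
  have hmain := twist_mul_integral_eq_of_perUnit h24ii h24iii h25 hK ι 𝔣 hle h𝔣0 h𝔣1 hv hw hq h2 u hσ₀ hε θ hθc hθ1 hθζ e₂ hΘe
    α hα0 hα𝔣 hαw f hαπ E hE hdegE hEE j hj hjC hjj ψ hψ idl hidl0 hidlc g hg x hx hstep μ c hμ m k hχc hχ h1 hne hχG a ha b hb cβ hcβ ιp hinj hT 𝒲 hχg w𝔭 h𝒲 A E₀ ψhat Ev hX hΦ e_v hW hST hST𝔭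
  set Θε : ℂ_[2] := (θ.comp ((CBall (v.adicCompletion K)).subtype.comp
    (algebraMap (UnrCoeff (v.adicCompletion K)) (CBall (v.adicCompletion K)))))
      (PowerSeries.coeff 1 (compSeriesC h2 hσ₀ u hε)) with hΘε
  have h12 : (12 : ℂ_[2]) ≠ 0 := by norm_num
  refine mul_left_cancel₀ h12 ?_
  calc (12 : ℂ_[2]) * ((((Ideal.absNorm (idl c) : ℂ_[2]) - χ (g c))) * I')
      = -(χ (g c) - (Ideal.absNorm (idl c) : ℂ_[2])) * ((12 : ℂ_[2]) * I') := by ring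
    _ = -(χ (g c) - (Ideal.absNorm (idl c) : ℂ_[2])) * (Θε * μ.integral χ) := by rw [hI]
    _ = -Θε * ((χ (g c) - (Ideal.absNorm (idl c) : ℂ_[2])) * μ.integral χ) := by ring
    _ = -Θε * (Θε ^ k * (-12 * A * ((ιp.symm ((1 - e_v) * S₀) : PadicAlgCl 2) : ℂ_[2]))) := by rw [hmain]
    _ = (12 : ℂ_[2]) * ((Θε * A₁) ^ (k + 1) * ((ιp.symm ((1 - e_v) * S₀) : PadicAlgCl 2) : ℂ_[2])) := by rw [hA]; ring

end Summit.BirchSwinnertonDyer.BirchSwinnertonDyer.Theorems.PrintCf2.KatzMeasureJZeroSeam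

end
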